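import Mathlib
import Literature.NumberTheory.Sieve.BombieriAsymptoticSieveMertens
import Literature.NumberTheory.Sieve.LevelOfDistribution
import Summits.Parity.GeneralizedHardyLittlewood.Theses.LiouvilleShiftedTables

/-!
# `PairsFromMAvg`, part 2: the weights `G_h = μ · (d/φ(d)) · 1_{(d,h)=1}` and `b_h = G_h ⋆ 1`

Route `LiouvilleShiftedTables` (Parity / GeneralizedHardyLittlewood), support item stmt-Parity-14275
(`PairsFromMAvg`). For the main-term bookkeeping of the opened pair sum we need the multiplicative
function `G_h(d) = μ(d) d/φ(d) 1_{(d,h)=1}` written as `b_h ⋆ μ` with `b_h = G_h ⋆ 1` multiplicative,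
`b_h(p^k) = 1` (`p ∣ h`), `= -1/(p-1)` (`p ∤ h`, `k ≥ 1`), and the uniform bound
`∑_{n ≤ N} |b_h(n)|/√n ≤ S_h` (Euler product over the primes `≤ N`, Mathlib's factored-numbers
Euler product via the tree's `BombieriSieve.sum_le_prod_tsum_of_factored`).

* `exists_weights` — existence of `G_h`, `b_h` as real arithmetic functions with these properties
  (no new definition is introduced: `G_h` is the pointwise product of `μ`, `id` and the tree's
  `shiftedPrimesDensity h`);
* `exists_sum_abs_div_sqrt_le` — `∑_{n ≤ N} |b(n)|/√n ≤ S` for every multiplicative `b` with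
  `|b(p^k)| ≤ 1`, `|b(p^k)| ≤ 1/(p-1)` off the prime divisors of `h ≠ 0`.

[folklore]
-/

noncomputable section

open Finset Real ArithmeticFunction Filter
open scoped ArithmeticFunction.Moebius ArithmeticFunction.zeta

namespace Summit.Parity.GeneralizedHardyLittlewood.Theorems.PairsFromMAvg

/-! ### The weights `G_h` and `b_h` -/

/-- **The weights of the opened pair sum.** For every `h` there are real arithmetic functions `G`, `b`,
both multiplicative, with `G(d) = μ(d) · d/φ(d) · 1_{(d,h)=1}`, `b ⋆ μ = G`, and
`b(p^k) = 1` if `p ∣ h`, `b(p^k) = -1/(p-1)` if `p ∤ h` (`p` prime, `k ≥ 1`); namely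
`G = μ · id · g_h` (`g_h` the shifted-primes density `1_{(d,h)=1}/φ(d)` of the tree) and `b = G ⋆ 1`.
[folklore] -/
theorem exists_weights (h : ℕ) :
    ∃ G b : ArithmeticFunction ℝ, G.IsMultiplicative ∧ b.IsMultiplicative ∧
      (∀ d : ℕ, G d = (μ d : ℝ) * ((d : ℝ) / Nat.totient d) * (if d.Coprime h then 1 else 0)) ∧
      b * (μ : ArithmeticFunction ℝ) = G ∧
      (∀ p k : ℕ, p.Prime → 1 ≤ k → b (p ^ k) = if p ∣ h then 1 else -1 / ((p : ℝ) - 1)) := by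
  set G : ArithmeticFunction ℝ := (μ : ArithmeticFunction ℝ).pmul
      (((ArithmeticFunction.id : ArithmeticFunction ℕ) : ArithmeticFunction ℝ).pmul
        (Literature.NumberTheory.Sieve.shiftedPrimesDensity h)) with hGdef
  have hGm : G.IsMultiplicative :=
    isMultiplicative_moebius.intCast.pmul
      (isMultiplicative_id.natCast.pmul
        (Literature.NumberTheory.Sieve.isMultiplicative_shiftedPrimesDensity h))
  have hG : ∀ d : ℕ, G d =
      (μ d : ℝ) * ((d : ℝ) / Nat.totient d) * (if d.Coprime h then 1 else 0) := by
    intro d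
    rw [hGdef, pmul_apply, pmul_apply, intCoe_apply, natCoe_apply, id_apply,
      Literature.NumberTheory.Sieve.shiftedPrimesDensity_apply]
    by_cases hd : d = 0
    · subst hd; simp
    · by_cases hc : d.Coprime h
      · rw [if_pos ⟨hc, hd⟩, if_pos hc, div_eq_mul_inv, mul_one]
      · rw [if_neg (fun h' => hc h'.1), if_neg hc]; ring
  refine ⟨G, G * (ζ : ArithmeticFunction ℝ), hGm, hGm.mul isMultiplicative_zeta.natCast, hG,
    ?_, ?_⟩
  · rw [mul_assoc, coe_zeta_mul_coe_moebius, mul_one]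
  · intro p k hp hk
    rw [coe_mul_zeta_apply, Nat.sum_divisors_prime_pow hp]
    have hp2 : (2 : ℝ) ≤ p := by exact_mod_cast hp.two_le
    have hp1 : (p : ℝ) - 1 ≠ 0 := by linarith
    have hG1 : G 1 = 1 := by rw [hG]; simp
    have hGp : G p = if p ∣ h then 0 else -(p : ℝ) / ((p : ℝ) - 1) := by
      rw [hG, moebius_apply_prime hp, Nat.totient_prime hp, Nat.cast_sub hp.one_le]
      by_cases hdvd : p ∣ h
      · rw [if_pos hdvd, if_neg (fun hc => (hp.coprime_iff_not_dvd.mp hc) hdvd)]; simp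
      · rw [if_neg hdvd, if_pos (hp.coprime_iff_not_dvd.mpr hdvd)]; push_cast; ring
    have hGpk : ∀ i, 2 ≤ i → G (p ^ i) = 0 := by
      intro i hi
      rw [hG, moebius_apply_prime_pow hp (by omega), if_neg (by omega)]
      simp
    have hsum : ∀ j, ∑ i ∈ Finset.range (j + 2), G (p ^ i) = 1 + G p := by
      intro j
      induction j with
      | zero => rw [Finset.sum_range_succ, Finset.sum_range_one, pow_zero, pow_one, hG1]
      | succ j ih =>
        rw [show j + 1 + 2 = (j + 2) + 1 by ring, Finset.sum_range_succ, ih, hGpk (j + 2) (by omega),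
          add_zero]
    obtain ⟨j, rfl⟩ : ∃ j, k = j + 1 := ⟨k - 1, by omega⟩
    rw [show j + 1 + 1 = j + 2 by ring, hsum, hGp]
    split_ifs
    · simp
    · field_simp; ring

/-! ### The uniform bound `∑_{n ≤ N} |b(n)|/√n ≤ S` -/

/-- `√(p^e) = (√p)^e`. [folklore] -/
theorem sqrt_natCast_pow (p e : ℕ) : Real.sqrt ((p ^ e : ℕ) : ℝ) = Real.sqrt p ^ e := by
  induction e with
  | zero => simp
  | succ e ih => rw [pow_succ, Nat.cast_mul, Real.sqrt_mul' _ (Nat.cast_nonneg p), ih, pow_succ]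

/-- Elementary: for `p ≥ 2`, `1/((p-1)(√p-1)) ≤ 8/(p √p)` (`p - 1 ≥ p/2`, `√p - 1 ≥ √p/4`). [folklore] -/
theorem inv_pred_mul_sqrt_pred_le {p : ℝ} (hp : 2 ≤ p) :
    1 / ((p - 1) * (Real.sqrt p - 1)) ≤ 8 / (p * Real.sqrt p) := by
  have hp0 : 0 < p := by linarith
  have hs2 : Real.sqrt 2 ≤ Real.sqrt p := Real.sqrt_le_sqrt hp
  have h14 : (1.4 : ℝ) ≤ Real.sqrt 2 := by
    rw [Real.le_sqrt (by norm_num) (by norm_num)]; norm_num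
  have hs : 1.4 ≤ Real.sqrt p := h14.trans hs2
  have hs0 : 0 < Real.sqrt p := by linarith
  have h1 : p / 2 ≤ p - 1 := by linarith
  have h2 : Real.sqrt p / 4 ≤ Real.sqrt p - 1 := by linarith
  have hpos : 0 < (p - 1) * (Real.sqrt p - 1) := mul_pos (by linarith) (by linarith)
  rw [div_le_div_iff₀ hpos (by positivity), one_mul]
  calc p * Real.sqrt p = 8 * ((p / 2) * (Real.sqrt p / 4)) := by ring
    _ ≤ 8 * ((p - 1) * (Real.sqrt p - 1)) := by gcongr; linarith

/-- **Uniform bound for `∑ |b(n)|/√n`.** If `b` is multiplicative with `b(p^k) = 1` for `p ∣ h` and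
`b(p^k) = -1/(p-1)` for `p ∤ h` (`k ≥ 1`, `h ≠ 0`), then `∑_{n ≤ N} |b(n)|/√n ≤ S` for some `S`
independent of `N` (Euler product: `∏_{p ≤ N} ∑_e |b(p^e)| p^{-e/2} ≤ exp(3h + 8 ∑ n^{-3/2})`).
[folklore] -/
theorem exists_sum_abs_div_sqrt_le {h : ℕ} (hh : h ≠ 0) (b : ArithmeticFunction ℝ)
    (hb : b.IsMultiplicative)
    (hbp : ∀ p k : ℕ, p.Prime → 1 ≤ k → b (p ^ k) = if p ∣ h then 1 else -1 / ((p : ℝ) - 1)) :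
    ∃ S : ℝ, ∀ N : ℕ, ∑ n ∈ Icc 1 N, |b n| / Real.sqrt n ≤ S := by
  set f : ℕ → ℝ := fun n => |b n| / Real.sqrt n with hf
  have hf1 : f 1 = 1 := by simp [hf, hb.map_one]
  have hfmul : ∀ {m n : ℕ}, Nat.Coprime m n → f (m * n) = f m * f n := by
    intro m n hmn
    simp only [hf]
    rw [hb.map_mul_of_coprime hmn, abs_mul, Nat.cast_mul, Real.sqrt_mul (Nat.cast_nonneg _),
      mul_div_mul_comm]
  have hf0 : ∀ n, 0 ≤ f n := fun n => div_nonneg (abs_nonneg _) (Real.sqrt_nonneg _)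
  -- the local data at a prime `p`
  have hβ1 : ∀ {p : ℕ}, p.Prime → |(if p ∣ h then (1 : ℝ) else -1 / ((p : ℝ) - 1))| ≤ 1 := by
    intro p hp
    have hp2 : (2 : ℝ) ≤ p := by exact_mod_cast hp.two_le
    split_ifs
    · simp
    · rw [abs_div, abs_neg, abs_one, abs_of_pos (by linarith), div_le_one (by linarith)]
      linarith
  have hfpe : ∀ {p : ℕ} (e : ℕ), p.Prime →
      f (p ^ (e + 1)) = |(if p ∣ h then (1 : ℝ) else -1 / ((p : ℝ) - 1))| *
        ((Real.sqrt p)⁻¹) ^ (e + 1) := by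
    intro p e hp
    simp only [hf]
    rw [hbp p (e + 1) hp (by omega), sqrt_natCast_pow, inv_pow, div_eq_mul_inv]
  have hr : ∀ {p : ℕ}, p.Prime → 0 ≤ (Real.sqrt p)⁻¹ ∧ (Real.sqrt p)⁻¹ ≤ 0.72 := by
    intro p hp
    have hp2 : (2 : ℝ) ≤ p := by exact_mod_cast hp.two_le
    have h14 : (1.4 : ℝ) ≤ Real.sqrt p := by
      refine le_trans ?_ (Real.sqrt_le_sqrt hp2)
      rw [Real.le_sqrt (by norm_num) (by norm_num)]; norm_num
    refine ⟨inv_nonneg.mpr (Real.sqrt_nonneg _), ?_⟩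
    rw [inv_le_comm₀ (by linarith) (by norm_num)]
    exact le_trans (by norm_num) h14
  have hfle : ∀ {p : ℕ} (e : ℕ), p.Prime → f (p ^ e) ≤ ((Real.sqrt p)⁻¹) ^ e := by
    intro p e hp
    rcases e with _ | e
    · simp [hf1]
    · rw [hfpe e hp]
      exact mul_le_of_le_one_left (pow_nonneg (hr hp).1 _) (hβ1 hp)
  have hfsum : ∀ {p : ℕ}, p.Prime → Summable (fun e : ℕ => f (p ^ e)) := by
    intro p hp
    refine Summable.of_nonneg_of_le (fun e => hf0 _) (fun e => hfle e hp)
      (summable_geometric_of_lt_one (hr hp).1 (by linarith [(hr hp).2]))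
  -- the local factor `T_p = ∑_e f(p^e) ≤ exp(t_p)` with `t_p ≤ 3·1_{p ∣ h} + 8/(p√p)`
  have hT : ∀ {p : ℕ}, p.Prime → ∑' e : ℕ, f (p ^ e) ≤
      Real.exp ((if p ∣ h then 3 else 0) + 8 / ((p : ℝ) * Real.sqrt p)) := by
    intro p hp
    have hp2 : (2 : ℝ) ≤ p := by exact_mod_cast hp.two_le
    obtain ⟨hr0, hr1⟩ := hr hp
    set r : ℝ := (Real.sqrt p)⁻¹ with hrdef
    set β : ℝ := |(if p ∣ h then (1 : ℝ) else -1 / ((p : ℝ) - 1))| with hβdef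
    have hr1' : r < 1 := by linarith
    rw [(hfsum hp).tsum_eq_zero_add, pow_zero, hf1]
    have htail : ∑' e : ℕ, f (p ^ (e + 1)) = β * r * (1 - r)⁻¹ := by
      rw [show (fun e : ℕ => f (p ^ (e + 1))) = fun e : ℕ => β * r * r ^ e from
        funext fun e => by rw [hfpe e hp, pow_succ]; ring]
      rw [tsum_mul_left, tsum_geometric_of_lt_one hr0 hr1']
    rw [htail]
    refine le_trans ?_ (Real.add_one_le_exp _)
    rw [add_comm]
    gcongr
    -- `β r/(1-r) ≤ 3·1_{p ∣ h} + 8/(p√p)`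
    have hsp : 0 < Real.sqrt p := Real.sqrt_pos.mpr (by linarith)
    have hgeo : r * (1 - r)⁻¹ = 1 / (Real.sqrt p - 1) := by
      rw [hrdef]; field_simp
    by_cases hdvd : p ∣ h
    · rw [hβdef, if_pos hdvd, if_pos hdvd, abs_one, one_mul]
      have : r * (1 - r)⁻¹ ≤ 3 := by
        rw [mul_inv_le_iff₀ (by linarith)]; linarith
      have h8 : 0 ≤ 8 / ((p : ℝ) * Real.sqrt p) := by positivity
      linarith
    · rw [hβdef, if_neg hdvd, if_neg hdvd, zero_add, abs_div, abs_neg, abs_one,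
        abs_of_pos (by linarith : (0 : ℝ) < p - 1), mul_assoc, hgeo]
      rw [show 1 / ((p : ℝ) - 1) * (1 / (Real.sqrt p - 1)) = 1 / ((p - 1) * (Real.sqrt p - 1)) by
        rw [one_div_mul_one_div]]
      exact inv_pred_mul_sqrt_pred_le hp2
  -- summing `t_p` over the primes `p ≤ N`
  have hZ : Summable (fun n : ℕ => 8 / ((n : ℝ) * Real.sqrt n)) := by
    have := (Real.summable_one_div_nat_rpow.mpr (by norm_num : (1 : ℝ) < 3 / 2)).mul_left 8
    refine this.congr fun n => ?_
    rw [show (3 / 2 : ℝ) = 1 + 1 / 2 by norm_num, Real.rpow_add' (Nat.cast_nonneg n) (by norm_num),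
      Real.rpow_one, ← Real.sqrt_eq_rpow]
    ring
  set Z : ℝ := ∑' n : ℕ, 8 / ((n : ℝ) * Real.sqrt n) with hZdef
  refine ⟨Real.exp (3 * h + Z), fun N => ?_⟩
  set s : Finset ℕ := (Finset.range (N + 1)).filter Nat.Prime with hs
  have hsp : ∀ p ∈ s, p.Prime := fun p hp => (Finset.mem_filter.mp hp).2
  have hfact : ∀ d ∈ Icc 1 N, d ∈ Nat.factoredNumbers s := by
    intro d hd
    obtain ⟨hd1, hdN⟩ := Finset.mem_Icc.mp hd
    rw [Nat.mem_factoredNumbers']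
    intro p hp hpd
    rw [hs, Finset.mem_filter, Finset.mem_range]
    exact ⟨Nat.lt_succ_of_le ((Nat.le_of_dvd hd1 hpd).trans hdN), hp⟩
  have hle := Literature.NumberTheory.Sieve.BombieriSieve.sum_le_prod_tsum_of_factored
    (h := f) hf1 hfmul hf0 hfsum hsp hfact
  refine hle.trans ?_
  calc ∏ p ∈ s, ∑' e : ℕ, f (p ^ e)
      ≤ ∏ p ∈ s, Real.exp ((if p ∣ h then 3 else 0) + 8 / ((p : ℝ) * Real.sqrt p)) :=
        Finset.prod_le_prod (fun p _ => tsum_nonneg fun e => hf0 _) fun p hp => hT (hsp p hp)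
    _ = Real.exp (∑ p ∈ s, ((if p ∣ h then (3 : ℝ) else 0) + 8 / ((p : ℝ) * Real.sqrt p))) :=
        (Real.exp_sum _ _).symm
    _ ≤ Real.exp (3 * h + Z) := by
        refine Real.exp_le_exp.mpr ?_
        rw [Finset.sum_add_distrib]
        refine add_le_add ?_ ?_
        · rw [← Finset.sum_filter, Finset.sum_const, nsmul_eq_mul]
          have hcard : ((s.filter (· ∣ h)).card : ℝ) ≤ h := by
            have h1 : s.filter (· ∣ h) ⊆ h.divisors := by
              intro p hp
              rw [Finset.mem_filter] at hp
              exact Nat.mem_divisors.mpr ⟨hp.2, hh⟩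
            calc ((s.filter (· ∣ h)).card : ℝ) ≤ (h.divisors.card : ℝ) := by
                  exact_mod_cast Finset.card_le_card h1
              _ ≤ h := by exact_mod_cast Nat.card_divisors_le_self h
          linarith
        · exact Summable.sum_le_tsum s (fun n _ => by positivity) hZ

end Summit.Parity.GeneralizedHardyLittlewood.Theorems.PairsFromMAvg
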